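import Literature.AlgebraicGeometry.Resolution.HasseSchmidtChartPurity
import Literature.AlgebraicGeometry.Resolution.SmoothChartOrderEquations
import HarnessLib

/-!
# Chart-uniform order AND purity equations on a scheme smooth over a perfect field

Topic: `Literature/AlgebraicGeometry/Resolution`. Scheme-level package of `HasseSchmidtChartOrder.lean` +
`HasseSchmidtChartPurity.lean`: `K` a PERFECT field of exponential characteristic `p`, `f : Z → Spec K` SMOOTH, `ξ ∈ Z`.
There are an affine open `V ∋ ξ`, `d`, and ONE Hasse–Schmidt homomorphism `T : Γ(Z,V) → Γ(Z,V)⟦t_1,…,t_d⟧`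
(`constantCoeff ∘ T = id`, fixing `K`; components `D^{[β]} = hsComponent T β` are `K`-linear differential operators of
order `≤ |β|`) such that at EVERY CLOSED `η ∈ V`, for every section `h ∈ Γ(Z,V)`:

* ORDER: `h_η ∈ 𝔪_η^N ⟺ (D^{[β]}h)_η ∈ 𝔪_η` for all `|β| < N`;
* PURITY (`q = p^e`, `h_η ∈ 𝔪_η^q`): `h_η ≡ y^q (mod 𝔪_η^{q+1})` for some `y ∈ 𝒪_{Z,η}` `⟺ (D^{[β]}h)_η ∈ 𝔪_η` for every
  NON-PURE `β` of degree `q` (`β ≠ q·e_m`).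

So along the chart the loci «`ord_η h ≥ N`», «`ord_η h = N`» and «the degree-`q` initial form of `h` at `η` is a `q`-th
power of a linear form» at closed points are all read off the vanishing / non-vanishing of the SAME finitely many global
sections `D^{[β]} h` (`exists_affineOpen_hasseSchmidt_orderPurity`).

Bearing (nothing of it asserted): the «chart-uniform Hasse–Taylor» input of the discharge route for GAP-LEDGER row R20
(Th. 6.14 (1) of H. Hironaka's 2017 manuscript; campaign `res-hironaka`, lead README §2 (i)–(iv)).
Sources: [EGAIV4] Thm. 16.11.2, §17.6; [Matsumura1987] §27, §30; [VillamayorU2008ReesDiff] §4.1, Remark 4.3;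
[Abad2019pBases] Lemma 6.2.
-/

noncomputable section

namespace Literature.AlgebraicGeometry.Resolution

open Finsupp IsLocalRing MvPowerSeries CategoryTheory TopologicalSpace _root_.AlgebraicGeometry

universe u

variable {K : Type u} [Field K] {Z : Scheme.{u}} (f : Z ⟶ Spec (.of K))

/-- **Chart-uniform order and purity equations on a smooth scheme over a perfect field** (exponential characteristic
`p`): for `f : Z → Spec K` smooth, `K` perfect, `ξ ∈ Z`, there are an affine open `V ∋ ξ`, `d` and ONE Hasse–Schmidt
homomorphism `T` of `Γ(Z,V)` fixing `K` (components = `K`-linear differential operators of order `≤ |β|`) such that at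
EVERY CLOSED `η ∈ V`: (order) `germ_η h ∈ 𝔪_η^N ⟺ ∀ |β| < N, germ_η (hsComponent T β h) ∈ 𝔪_η`; (purity) for
`germ_η h ∈ 𝔪_η^{p^e}`: `(∃ y, germ_η h − y^{p^e} ∈ 𝔪_η^{p^e+1}) ⟺ ∀ β` non-pure of degree `p^e`,
`germ_η (hsComponent T β h) ∈ 𝔪_η`. [cite: EGAIV4, Thm. 16.11.2 and §17.6] [cite: Matsumura1987, §27 and §30]
[cite: VillamayorU2008ReesDiff, §4.1 and Remark 4.3] [cite: Abad2019pBases, Lemma 6.2] -/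
theorem exists_affineOpen_hasseSchmidt_orderPurity [PerfectField K] (p : ℕ) [ExpChar K p] [Smooth f] (ξ : Z) :
    ∃ (V : Z.Opens) (_ : IsAffineOpen V) (_ : ξ ∈ V) (d : ℕ)
      (T : Γ(Z, V) →+* MvPowerSeries (Fin d) Γ(Z, V)),
      (∀ a, constantCoeff (T a) = a) ∧
      (∀ c : K, T (sectionsHom (f.appTop.hom.comp (Scheme.ΓSpecIso (.of K)).inv.hom) V c) =
        MvPowerSeries.C (sectionsHom (f.appTop.hom.comp (Scheme.ΓSpecIso (.of K)).inv.hom) V c)) ∧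
      (letI := sectionsAlgebra (f.appTop.hom.comp (Scheme.ΓSpecIso (.of K)).inv.hom) V
       ∀ β : Fin d →₀ ℕ, ∃ D : Γ(Z, V) →ₗ[K] Γ(Z, V), IsDiffOpLE K (degree β) D ∧ ∀ a, D a = hsComponent T β a) ∧
      ∀ (η : Z) (hη : η ∈ V), IsClosed ({η} : Set Z) → ∀ h : Γ(Z, V),
        (∀ N : ℕ, (Z.presheaf.germ V η hη).hom h ∈ maximalIdeal (Z.presheaf.stalk η) ^ N ↔
          ∀ β : Fin d →₀ ℕ, degree β < N →
            (Z.presheaf.germ V η hη).hom (hsComponent T β h) ∈ maximalIdeal (Z.presheaf.stalk η)) ∧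
        ∀ e : ℕ, (Z.presheaf.germ V η hη).hom h ∈ maximalIdeal (Z.presheaf.stalk η) ^ p ^ e →
          ((∃ y : Z.presheaf.stalk η,
              (Z.presheaf.germ V η hη).hom h - y ^ p ^ e ∈ maximalIdeal (Z.presheaf.stalk η) ^ (p ^ e + 1)) ↔
            ∀ β : Fin d →₀ ℕ, degree β = p ^ e → (∀ m, β ≠ p ^ e • Finsupp.single m 1) →
              (Z.presheaf.germ V η hη).hom (hsComponent T β h) ∈ maximalIdeal (Z.presheaf.stalk η)) := by
  set φ₀ : K →+* Γ(Z, ⊤) := f.appTop.hom.comp (Scheme.ΓSpecIso (.of K)).inv.hom with hφ₀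
  -- a standard smooth affine chart at `ξ`
  have hx : ξ ∈ f.smoothLocus := by
    rw [Scheme.Hom.smoothLocus_eq_top]
    trivial
  obtain ⟨d, ⟨U, hU⟩, ⟨V, hV⟩, hξV, e', hstd⟩ :=
    Literature.AlgebraicGeometry.Motives.exists_appLE_isStandardSmoothOfRelativeDimension_of_mem_smoothLocus f hx
  have hUtop : U = ⊤ := by
    ext y
    simp only [Opens.coe_top, Set.mem_univ, iff_true]
    have : f ξ ∈ U := e' hξV
    rwa [Subsingleton.elim y (f ξ)]
  subst hUtop
  have hφ : sectionsHom φ₀ V =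
      (f.appLE ⊤ V e').hom.comp (Scheme.ΓSpecIso (.of K)).commRingCatIsoToRingEquiv.symm.toRingHom := rfl
  have hφstd : (sectionsHom φ₀ V).IsStandardSmoothOfRelativeDimension d := by
    rw [hφ]
    exact RingHom.isStandardSmoothOfRelativeDimension_respectsIso.2 _ _ hstd
  obtain ⟨g, hgC, hgEt⟩ := RingHom.IsStandardSmoothOfRelativeDimension.exists_etale_mvPolynomial hφstd
  -- algebra structures `K → K[X] → Γ(Z, V)`
  letI : Algebra K Γ(Z, V) := sectionsAlgebra φ₀ V
  letI : Algebra (MvPolynomial (Fin d) K) Γ(Z, V) := g.toAlgebra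
  haveI : IsScalarTower K (MvPolynomial (Fin d) K) Γ(Z, V) :=
    IsScalarTower.of_algebraMap_eq (R := K) (S := MvPolynomial (Fin d) K) (A := Γ(Z, V)) fun c => by
      show sectionsHom φ₀ V c = g (algebraMap K (MvPolynomial (Fin d) K) c)
      rw [MvPolynomial.algebraMap_eq, ← hgC]
      rfl
  haveI : Algebra.Etale (MvPolynomial (Fin d) K) Γ(Z, V) := hgEt
  haveI : Algebra.FormallyEtale (MvPolynomial (Fin d) K) Γ(Z, V) := Algebra.Etale.formallyEtale
  haveI : Algebra.FinitePresentation (MvPolynomial (Fin d) K) Γ(Z, V) := Algebra.Etale.finitePresentation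
  haveI : Algebra.FiniteType K Γ(Z, V) :=
    Algebra.FiniteType.trans (S := MvPolynomial (Fin d) K) inferInstance inferInstance
  -- ONE Hasse–Schmidt homomorphism on the chart
  obtain ⟨T, hT0, hTK, hTx, hD, -⟩ :=
    exists_hasseSchmidt_orderEquations K (σ := Fin d) (A := Γ(Z, V))
  refine ⟨V, hV, hξV, d, T, hT0, fun c => hTK c, hD, fun η hη hηc h => ?_⟩
  -- a closed point `η ∈ V` is a maximal ideal of `Γ(Z, V)` and `𝒪_{Z,η}` is the localisation there
  letI : Algebra Γ(Z, V) (Z.presheaf.stalk η) := TopCat.Presheaf.algebra_section_stalk Z.presheaf ⟨η, hη⟩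
  haveI : IsLocalization.AtPrime (Z.presheaf.stalk η) (hV.primeIdealOf ⟨η, hη⟩).asIdeal :=
    hV.isLocalization_stalk ⟨η, hη⟩
  haveI : (hV.primeIdealOf ⟨η, hη⟩).asIdeal.IsMaximal := hV.primeIdealOf_isMaximal_of_isClosed ⟨η, hη⟩ hηc
  have hgerm : ∀ s : Γ(Z, V), algebraMap Γ(Z, V) (Z.presheaf.stalk η) s = (Z.presheaf.germ V η hη).hom s :=
    fun _ => rfl
  constructor
  · intro N
    have key := algebraMap_mem_maximalIdeal_pow_iff_of_hasseSchmidt K (σ := Fin d) T hT0 hTK hTx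
      (hV.primeIdealOf ⟨η, hη⟩).asIdeal (Z.presheaf.stalk η) N h
    rw [hgerm] at key
    rw [key]
    refine forall_congr' fun β => forall_congr' fun _ => ?_
    rw [← hgerm, IsLocalization.AtPrime.to_map_mem_maximal_iff (Z.presheaf.stalk η) (hV.primeIdealOf ⟨η, hη⟩).asIdeal]
  · intro e hh
    have hh' : h ∈ (hV.primeIdealOf ⟨η, hη⟩).asIdeal ^ p ^ e := by
      rw [mem_pow_iff_algebraMap_mem_maximalIdeal_pow _ (Z.presheaf.stalk η), hgerm]
      exact hh
    have key := sub_pow_mem_iff_hsComponent_mem_of_hasseSchmidt K p (σ := Fin d) T hT0 hTK hTx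
      (hV.primeIdealOf ⟨η, hη⟩).asIdeal (Z.presheaf.stalk η) e hh'
    rw [hgerm] at key
    rw [key]
    refine forall_congr' fun β => forall_congr' fun _ => forall_congr' fun _ => ?_
    rw [← hgerm, IsLocalization.AtPrime.to_map_mem_maximal_iff (Z.presheaf.stalk η) (hV.primeIdealOf ⟨η, hη⟩).asIdeal]

end Literature.AlgebraicGeometry.Resolution

end
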